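import Literature.AlgebraicGeometry.Motives.GrassmannianUniversalChartData
import Literature.AlgebraicGeometry.Modules.PullbackFrame
import Literature.AlgebraicGeometry.Modules.DetClassOfIso
import Mathlib.RingTheory.LocalProperties.Submodule
import HarnessLib

/-!
# Every `T`-point of the Grassmannian classifies its own pull-back of the universal quotient

Topic `AlgebraicGeometry/Motives`; namespace `Literature.AlgebraicGeometry.Motives.Grassmannian`.  THEOREMS ONLY (no definition,
no instance, no notation, no named fact, no `sorry`).  Part G2(d) of the cell's (h4) brick (Q3) «the universal quotient on
`grassmannianScheme M k`» (B-p21 (g16) ★ G1 `GrassmannianUniversalQuotient`, ★ G2a `GrassmannianUniversalQuotientClassify`;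
B-p18 ★ FILE B `GrassmannianChartTautologicalQuotient`, ★ FILE C `GrassmannianUniversalChartData`): the universal quotient
`π : 𝒪_{Gr}^{(J)} ↠ 𝒬` with sections `q_j = π(1 ⊗ b_j)` (★ `universalQuotient`, `universalQuotientSection`) pulled back along ANY
`f : T ⟶ grassmannianScheme M k` — `f^*𝒬 = (Scheme.Modules.pullback f).obj 𝒬` with the pulled-back sections `η(q_j) ∈ Γ(f^*𝒬, T)`
(★ `Modules.unitSection`) — is the rank-`k` quotient of `𝒪_T ⊗ M` NAMED BY THE POINT `f`: on every affine open `V ⊆ T`,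

  `ker (θ_V : Γ(T, V) ⊗ M → Γ(f^*𝒬, V)) = (evalAffine V (pointsEquiv f)).toSubmodule`   (`ker_sectionsMap_pullback_universalQuotient`),

hence **`forall_evalAffine_eq_ker_pullback_iff`**: a morphism `g` has the classifying property of ★ `existsUnique_hom_ker_sectionsMap`
for `f^*(𝒬, q)` iff `g = f` ([GortzWedhorn2020, (8.4) (pp. 213–215)]: `Grass` represents the rank-`k` quotients of `𝒪 ⊗ M`, with
universal object `(𝒬, q)`).  Chart data do NOT pull back (`f⁻¹U_I` need not be affine), the tautological RELATION does:

* §1 transport along `f : T ⟶ T₀` for any module `Q₀` framed by `e₀` over `U ⊆ T₀` with sections `q_j` satisfying the tautological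
  relation of ★ FILE B on an affine `W ⊆ U` w.r.t. `y₀ ∈ Gr(T₀)`: `unitSection_eq_sum_of_eq_sum` (★ `basisSection_pullbackFrame`),
  `coordMap_evalAffine_map` (★ `evalAffine_map` + ★ `coordMap_map`), **`tautological_pullback`** (the relation for
  `(f^*Q₀, η(q), f^*e₀, Gr(f) y₀)` on every affine `V ⊆ f⁻¹W`), `ker_sectionsMap_pullback_of_le`, `sectionsMap_pullback_surjective_of_le`;
* §2 **`ker_sectionsMap_eq_evalAffine_of_cover`** — for an affine-localizing `Q`, the kernel identity `ker θ_V = y|_V` on the affine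
  opens subordinate to an open cover implies it on EVERY affine open (localise at the basic opens, Mathlib
  `Submodule.eq_of_isLocalized'_span`; B-p21's G2a argument for an arbitrary module and cover);
* §3 the universal case `T₀ = grassmannianScheme M k`, `y₀ = pointsEquiv 𝟙` (`pointsEquiv f = Gr(f) y₀`): `hasRank_pullback_universalQuotient`,
  `ker_sectionsMap_pullback_universalQuotient(_of_le)`, `sectionsMap_pullback_universalQuotient_surjective_of_le`,
  **`forall_evalAffine_eq_ker_pullback_iff`**, `existsUnique_evalAffine_eq_ker_pullback`, and the case `f = 𝟙`
  (`forall_evalAffine_eq_ker_universalQuotient_iff`: the universal quotient is classified by the identity).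

[GortzWedhorn2020, (8.4) (pp. 213–215); Thm. 7.12 (p. 185) with Cor. 7.17 (p. 188)]; [Hartshorne1977, II.5 (p. 110)] (`f^*`);
[StacksProject, Tag 089R / 089T / 00EO].  Cell `hodgecm-mathlib` (D-0151), count-neutral Mathlib-side capital; nothing here is about HC —
HC_CM is proved only modulo the 7 printed citations until rung 0 closes.
-/

noncomputable section
-- `TopCat.Presheaf`/`Scheme.Modules` are not reducible (as in Mathlib's `AlgebraicGeometry/Modules/Tilde.lean`).
set_option backward.isDefEq.respectTransparency false

namespace Literature.AlgebraicGeometry.Motives.Grassmannian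

open CategoryTheory Opposite TensorProduct TopologicalSpace _root_.AlgebraicGeometry
open Literature.AlgebraicGeometry.Modules

universe u

variable {k : ℕ} {M : Type u} [AddCommGroup M] {J : Type u} (b : Module.Basis J ℤ M)

/-! ## §1 Transport of the tautological relation along `f : T ⟶ T₀` -/

section Transport

variable {T T₀ : Scheme.{u}} (f : T ⟶ T₀) (Q₀ : T₀.Modules) (q₀ : J → Γ(Q₀, ⊤))

/-- Restricting the pulled-back global section `η(q_j) ∈ Γ(f^*Q₀, T)` to `f⁻¹W` gives the pull-back of `q_j|_W`
(★ `unitSection_map`). [cite: Hartshorne1977, II.5 (p. 110)] -/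
theorem map_unitSection_top (W : T₀.Opens) (s : Γ(Q₀, ⊤)) :
    ((Scheme.Modules.pullback f).obj Q₀).presheaf.map (homOfLE (le_top : f ⁻¹ᵁ W ≤ ⊤)).op (unitSection f Q₀ ⊤ s) =
      unitSection f Q₀ W (Q₀.presheaf.map (homOfLE (le_top : W ≤ ⊤)).op s) := by
  rw [unitSection_map]
  rfl

variable {ι : Type u} [Fintype ι] {U : T₀.Opens} (e₀ : SheafOfModules.free ι ≅ Q₀.over U)

/-- **Pull-back of a frame expansion**: if `s = Σᵢ cᵢ · e₀ᵢ|_W` over `W ≤ U` then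
`η(s) = Σᵢ f♯(cᵢ) · (f^*e₀)ᵢ|_{f⁻¹W}` for the pulled-back frame `f^*e₀` of `f^*Q₀` over `f⁻¹U` (★ `basisSection_pullbackFrame`).
[cite: Hartshorne1977, II.5 (p. 110)] -/
theorem unitSection_eq_sum_of_eq_sum {W : T₀.Opens} (kW : W ⟶ U) (s : Γ(Q₀, W)) (c : ι → Γ(T₀, W))
    (hs : s = ∑ i, c i • Q₀.presheaf.map kW.op (basisSection e₀ i)) :
    unitSection f Q₀ W s = ∑ i, f.app W (c i) •
      ((Scheme.Modules.pullback f).obj Q₀).presheaf.map ((Opens.map f.base).map kW).op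
        (basisSection (E := (Scheme.Modules.pullback f).obj Q₀) (pullbackFrame f e₀) i) := by
  rw [hs, unitSection_sum]
  refine Finset.sum_congr rfl fun i _ => ?_
  rw [unitSection_smul, unitSection_map, basisSection_pullbackFrame]

variable {f Q₀}

/-- **Chart coordinates are natural along `f`**: for affine opens `W ⊆ T₀`, `V ⊆ f⁻¹W` and a section `y₀ ∈ Gr(T₀)` with
`y₀|_W ∈ chart x`, `coordMap x ((f^*y₀)|_V) m = f♯_{W,V} (coordMap x (y₀|_W) m)` (★ `evalAffine_map` + ★ `coordMap_map`).
[cite: GortzWedhorn2020, (8.4) (pp. 213–215)] [cite: StacksProject, Tag 089T] -/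
theorem coordMap_evalAffine_map {W : T₀.Opens} {V : T.Opens} (hW : IsAffineOpen W) (hV : IsAffineOpen V) (i : V ≤ f ⁻¹ᵁ W)
    (y₀ : (grassmannianSheaf M k).obj.obj (op T₀)) (x : Fin k → M) (hx : evalAffine hW y₀ ∈ chart ℤ M k x Γ(T₀, W))
    (hx' : evalAffine hV ((grassmannianSheaf M k).obj.map f.op y₀) ∈ chart ℤ M k x Γ(T, V)) (m : M) (l : Fin k) :
    coordMap x (evalAffine hV ((grassmannianSheaf M k).obj.map f.op y₀)) hx' m l =
      f.appLE W V i (coordMap x (evalAffine hW y₀) hx m l) := by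
  rw [coordMap_congr x (evalAffine_map f hW hV i y₀) hx' (map_mem_chart _ hx), coordMap_map]
  rfl

/-- Chart membership is preserved along `f`: `y₀|_W ∈ chart x ⟹ (f^*y₀)|_V ∈ chart x` for `V ⊆ f⁻¹W`.
[cite: StacksProject, Tag 089T] -/
theorem evalAffine_map_mem_chart {W : T₀.Opens} {V : T.Opens} (hW : IsAffineOpen W) (hV : IsAffineOpen V) (i : V ≤ f ⁻¹ᵁ W)
    (y₀ : (grassmannianSheaf M k).obj.obj (op T₀)) (x : Fin k → M) (hx : evalAffine hW y₀ ∈ chart ℤ M k x Γ(T₀, W)) :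
    evalAffine hV ((grassmannianSheaf M k).obj.map f.op y₀) ∈ chart ℤ M k x Γ(T, V) := by
  rw [evalAffine_map f hW hV i y₀]
  exact map_mem_chart _ hx

variable (σ : ι ≃ Fin k) {W : T₀.Opens} (kW : W ⟶ U) (hW : IsAffineOpen W) (y₀ : (grassmannianSheaf M k).obj.obj (op T₀))
  (x : Fin k → M) (hx : evalAffine hW y₀ ∈ chart ℤ M k x Γ(T₀, W))
  (hq₀ : ∀ j, Q₀.presheaf.map (homOfLE le_top).op (q₀ j) =
    ∑ i, coordMap x (evalAffine hW y₀) hx (b j) (σ i) • Q₀.presheaf.map kW.op (basisSection e₀ i))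
  {V : T.Opens} (hV : IsAffineOpen V) (i : V ≤ f ⁻¹ᵁ W)

include hq₀ in
/-- **THE TAUTOLOGICAL RELATION PULLS BACK**: if on the affine open `W ⊆ T₀` the sections `q_j` have the tautological coordinates of
`y₀|_W` in the frame `e₀` (★ FILE B `hq`), then on every affine `V ⊆ f⁻¹W` the pulled-back sections `η(q_j) ∈ Γ(f^*Q₀, T)` have the
tautological coordinates of `(f^*y₀)|_V` in the pulled-back frame `f^*e₀`. [cite: GortzWedhorn2020, (8.4) (pp. 213–215)]
[cite: Hartshorne1977, II.5 (p. 110)] -/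
theorem tautological_pullback (hx' : evalAffine hV ((grassmannianSheaf M k).obj.map f.op y₀) ∈ chart ℤ M k x Γ(T, V)) (j : J) :
    ((Scheme.Modules.pullback f).obj Q₀).presheaf.map (homOfLE le_top).op (unitSection f Q₀ ⊤ (q₀ j)) =
      ∑ l, coordMap x (evalAffine hV ((grassmannianSheaf M k).obj.map f.op y₀)) hx' (b j) (σ l) •
        ((Scheme.Modules.pullback f).obj Q₀).presheaf.map (homOfLE i ≫ (Opens.map f.base).map kW).op
          (basisSection (E := (Scheme.Modules.pullback f).obj Q₀) (pullbackFrame f e₀) l) := by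
  have h1 : ((Scheme.Modules.pullback f).obj Q₀).presheaf.map (homOfLE (le_top : V ≤ ⊤)).op (unitSection f Q₀ ⊤ (q₀ j)) =
      ((Scheme.Modules.pullback f).obj Q₀).presheaf.map (homOfLE i).op
        (((Scheme.Modules.pullback f).obj Q₀).presheaf.map (homOfLE (le_top : f ⁻¹ᵁ W ≤ ⊤)).op
          (unitSection f Q₀ ⊤ (q₀ j))) := by
    rw [presheaf_map_map]
    rfl
  rw [h1, map_unitSection_top, unitSection_eq_sum_of_eq_sum f Q₀ e₀ kW _ _ (hq₀ j), map_sum]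
  refine Finset.sum_congr rfl fun l _ => ?_
  rw [Scheme.Modules.map_smul, presheaf_map_map, coordMap_evalAffine_map hW hV i y₀ x hx hx']
  rfl

include hq₀ hV i in
/-- **Kernel of the sections map of the pull-back, on an affine `V ⊆ f⁻¹W`**:
`ker (θ_V : Γ(T, V) ⊗ M → Γ(f^*Q₀, V)) = ((f^*y₀)|_V).toSubmodule` (★ FILE B `ker_sectionsMap_eq_evalAffine`).
[cite: GortzWedhorn2020, (8.4) (pp. 213–215)] [cite: StacksProject, Tag 089R] -/
theorem ker_sectionsMap_pullback_of_le :
    LinearMap.ker (sectionsMap b ((Scheme.Modules.pullback f).obj Q₀) (fun j => unitSection f Q₀ ⊤ (q₀ j)) V) =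
      (evalAffine hV ((grassmannianSheaf M k).obj.map f.op y₀)).toSubmodule :=
  ker_sectionsMap_eq_evalAffine b _ _ σ (pullbackFrame f e₀) (homOfLE i ≫ (Opens.map f.base).map kW) hV _ x
    (evalAffine_map_mem_chart hW hV i y₀ x hx)
    (tautological_pullback b q₀ e₀ σ kW hW y₀ x hx hq₀ hV i (evalAffine_map_mem_chart hW hV i y₀ x hx))

include hq₀ hV i in
/-- The sections map `θ_V` of the pull-back is surjective on an affine `V ⊆ f⁻¹W` (★ FILE B `sectionsMap_surjective_of_tautological`).
[cite: GortzWedhorn2020, (8.4) (pp. 213–215)] -/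
theorem sectionsMap_pullback_surjective_of_le :
    Function.Surjective (sectionsMap b ((Scheme.Modules.pullback f).obj Q₀) (fun j => unitSection f Q₀ ⊤ (q₀ j)) V) :=
  sectionsMap_surjective_of_tautological b _ _ σ (pullbackFrame f e₀) (homOfLE i ≫ (Opens.map f.base).map kW) hV _ x
    (evalAffine_map_mem_chart hW hV i y₀ x hx)
    (tautological_pullback b q₀ e₀ σ kW hW y₀ x hx hq₀ hV i (evalAffine_map_mem_chart hW hV i y₀ x hx))

end Transport

/-! ## §2 Kernels of the sections maps are local on the affine opens -/

section Local

variable {T : Scheme.{u}} (Q : T.Modules) (q : J → Γ(Q, ⊤)) (y : (grassmannianSheaf M k).obj.obj (op T))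
  {α : Type*} (U : α → T.Opens) (hcov : ∀ t : T, ∃ a, t ∈ U a)

include hcov in
/-- On an affine open `V`, the sections `r ∈ Γ(T, V)` whose basic open `D(r)` lies in some member of an open cover of `T`
generate the unit ideal. [cite: GortzWedhorn2020, Thm. 7.12 (p. 185) with Cor. 7.17 (p. 188)] -/
theorem span_setOf_basicOpen_le_eq_top_of_cover {V : T.Opens} (hV : IsAffineOpen V) :
    Ideal.span {r : Γ(T, V) | ∃ a, T.basicOpen r ≤ U a} = ⊤ := by
  rw [← hV.self_le_iSup_basicOpen_iff]
  intro t ht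
  obtain ⟨a, hta⟩ := hcov t
  obtain ⟨r, hrle, htr⟩ := hV.exists_basicOpen_le (V := V ⊓ U a) ⟨t, ht, hta⟩ ht
  exact Opens.mem_iSup.mpr ⟨⟨r, a, hrle.trans inf_le_right⟩, htr⟩

include hcov in
/-- **KERNEL IDENTITY IS LOCAL**: let `Q` be affine-localizing (e.g. finite locally free) with global sections `q_j`, and
`y ∈ Gr(T)`.  If `ker θ_W = (y|_W).toSubmodule` for every affine open `W` contained in a member of an open cover `(U_a)` of `T`,
then `ker θ_V = (y|_V).toSubmodule` for EVERY affine open `V ⊆ T`: both sides localise to the corresponding objects on the basic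
opens `D(r) ⊆ V` (★ `localized'_ker_sectionsMap`, ★ `map_toSubmodule_eq_localized'` with ★ `evalAffine_of_le`), they agree there
for the `r` with `D(r)` inside the cover, and those `r` generate the unit ideal (Mathlib `Submodule.eq_of_isLocalized'_span`).
This is B-p21's `ChartData.ker_sectionsMap_quotientSection` argument for an arbitrary module and cover.
[cite: GortzWedhorn2020, (8.4) (pp. 213–215)] [cite: StacksProject, Tag 00EO] -/
theorem ker_sectionsMap_eq_evalAffine_of_cover (hQ : IsAffineLocalizing Q)
    (hloc : ∀ (a : α) (W : T.Opens) (hW : IsAffineOpen W), W ≤ U a →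
      LinearMap.ker (sectionsMap b Q q W) = (evalAffine hW y).toSubmodule)
    {V : T.Opens} (hV : IsAffineOpen V) :
    LinearMap.ker (sectionsMap b Q q V) = (evalAffine hV y).toSubmodule := by
  set s : Set Γ(T, V) := {r : Γ(T, V) | ∃ a, T.basicOpen r ≤ U a} with hs
  haveI : ∀ r : s, IsLocalization.Away (r.1 : Γ(T, V)) Γ(T, T.basicOpen (r.1 : Γ(T, V))) :=
    fun r => hV.isLocalization_basicOpen r.1
  refine Submodule.eq_of_isLocalized'_span s (span_setOf_basicOpen_le_eq_top_of_cover U hcov hV)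
    (fun r => Γ(T, T.basicOpen (r.1 : Γ(T, V)))) (fun r => Γ(T, T.basicOpen (r.1 : Γ(T, V))) ⊗[ℤ] M)
    (fun r => AlgebraTensorModule.rTensor ℤ M (Algebra.linearMap Γ(T, V) Γ(T, T.basicOpen (r.1 : Γ(T, V)))))
    fun r => ?_
  obtain ⟨a, ha⟩ := r.2
  have hφ : (T.presheaf.map (homOfLE (T.basicOpen_le (r.1 : Γ(T, V)))).op).hom.toIntAlgHom =
      IsScalarTower.toAlgHom ℤ Γ(T, V) Γ(T, T.basicOpen (r.1 : Γ(T, V))) := AlgHom.ext fun _ => rfl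
  rw [localized'_ker_sectionsMap b Q q hV r.1 hQ, hloc a _ (hV.basicOpen r.1) ha,
    evalAffine_of_le hV (hV.basicOpen r.1) (T.basicOpen_le r.1) y, hφ,
    map_toSubmodule_eq_localized' (.powers (r.1 : Γ(T, V)))]

end Local

/-! ## §3 THE UNIVERSAL CASE: every `f : T ⟶ grassmannianScheme M k` classifies its own pull-back `f^*(𝒬, q)` -/

section Universal

variable (k M) [(grassmannianSheaf M k).obj.IsRepresentable] {T : Scheme.{u}} (f : T ⟶ grassmannianScheme M k)

/-- The point of `f` is the pull-back of the universal point: `pointsEquiv f = Gr(f) (pointsEquiv 𝟙)`.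
[cite: GortzWedhorn2020, (8.4) (pp. 213–215)] -/
theorem pointsEquiv_eq_map_pointsEquiv_id :
    pointsEquiv M k T f = (grassmannianSheaf M k).obj.map f.op (pointsEquiv M k _ (𝟙 (grassmannianScheme M k))) := by
  rw [← pointsEquiv_comp, Category.comp_id]

/-- **The pull-back `f^*𝒬` of the universal quotient has rank `k`.** [cite: GortzWedhorn2020, (8.4) (pp. 213–215)] -/
theorem hasRank_pullback_universalQuotient : HasRank ((Scheme.Modules.pullback f).obj (universalQuotient k M b)) k :=
  hasRank_pullback f (hasRank_universalQuotient k M b)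

/-- The pull-back `f^*𝒬` is affine-localizing (finite locally free). [cite: GortzWedhorn2020, (8.4) (pp. 213–215)] -/
theorem isAffineLocalizing_pullback_universalQuotient : IsAffineLocalizing ((Scheme.Modules.pullback f).obj (universalQuotient k M b)) :=
  isAffineLocalizing_of_isFiniteLocallyFree (HasRank.isFiniteLocallyFree' (hasRank_pullback_universalQuotient k M b f))

/-- **Kernel identity for `f^*(𝒬, q)` on an affine `V ⊆ f⁻¹U_I`**: `ker θ_V = (pointsEquiv f)|_V` (§1 at the universal chart `U_I`,
★ `ChartData.map_quotientSection_eq_sum` on ★ `universalChartData`). [cite: GortzWedhorn2020, (8.4) (pp. 213–215)] [cite: StacksProject, Tag 089R] -/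
theorem ker_sectionsMap_pullback_universalQuotient_of_le (I : {I : Fin k → J // Function.Injective I}) {V : T.Opens}
    (hV : IsAffineOpen V) (hVI : V ≤ f ⁻¹ᵁ ((chartOpenCover k M b).f I).opensRange) :
    LinearMap.ker (sectionsMap b ((Scheme.Modules.pullback f).obj (universalQuotient k M b))
        (fun j => unitSection f (universalQuotient k M b) ⊤ (universalQuotientSection k M b j)) V) =
      (evalAffine hV (pointsEquiv M k T f)).toSubmodule := by
  rw [pointsEquiv_eq_map_pointsEquiv_id]
  exact ker_sectionsMap_pullback_of_le b (universalQuotientSection k M b) ((universalChartData k M b).quotientFrame I)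
    Equiv.ulift (homOfLE le_rfl) (isAffineOpen_opensRange_chartι k M b I) (pointsEquiv M k _ (𝟙 _)) (⇑b ∘ I.1)
    ((universalChartData k M b).evalAffine_mem_chart (isAffineOpen_opensRange_chartι k M b I) le_rfl)
    (fun j => (universalChartData k M b).map_quotientSection_eq_sum j I (isAffineOpen_opensRange_chartι k M b I) le_rfl) hV hVI

/-- On an affine `V ⊆ f⁻¹U_I` the sections map of `f^*(𝒬, q)` is surjective. [cite: GortzWedhorn2020, (8.4) (pp. 213–215)] -/
theorem sectionsMap_pullback_universalQuotient_surjective_of_le (I : {I : Fin k → J // Function.Injective I}) {V : T.Opens}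
    (hV : IsAffineOpen V) (hVI : V ≤ f ⁻¹ᵁ ((chartOpenCover k M b).f I).opensRange) :
    Function.Surjective (sectionsMap b ((Scheme.Modules.pullback f).obj (universalQuotient k M b))
      (fun j => unitSection f (universalQuotient k M b) ⊤ (universalQuotientSection k M b j)) V) :=
  sectionsMap_pullback_surjective_of_le b (universalQuotientSection k M b) ((universalChartData k M b).quotientFrame I)
    Equiv.ulift (homOfLE le_rfl) (isAffineOpen_opensRange_chartι k M b I) (pointsEquiv M k _ (𝟙 _)) (⇑b ∘ I.1)
    ((universalChartData k M b).evalAffine_mem_chart (isAffineOpen_opensRange_chartι k M b I) le_rfl)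
    (fun j => (universalChartData k M b).map_quotientSection_eq_sum j I (isAffineOpen_opensRange_chartι k M b I) le_rfl) hV hVI

/-- **KERNEL IDENTITY FOR `f^*(𝒬, q)` ON EVERY AFFINE OPEN `V ⊆ T`**: `ker (θ_V : Γ(T, V) ⊗ M → Γ(f^*𝒬, V)) = (pointsEquiv f)|_V` —
the quotient `f^*𝒬` of `𝒪_T ⊗ M` is the one named by the `T`-point `f` (§2 on the cover `f⁻¹U_I`).
[cite: GortzWedhorn2020, (8.4) (pp. 213–215)] [cite: StacksProject, Tag 089R] -/
theorem ker_sectionsMap_pullback_universalQuotient {V : T.Opens} (hV : IsAffineOpen V) :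
    LinearMap.ker (sectionsMap b ((Scheme.Modules.pullback f).obj (universalQuotient k M b))
        (fun j => unitSection f (universalQuotient k M b) ⊤ (universalQuotientSection k M b j)) V) =
      (evalAffine hV (pointsEquiv M k T f)).toSubmodule :=
  ker_sectionsMap_eq_evalAffine_of_cover b _ _ (pointsEquiv M k T f)
    (fun I : {I : Fin k → J // Function.Injective I} => f ⁻¹ᵁ ((chartOpenCover k M b).f I).opensRange)
    (fun t => exists_mem_opensRange_chartι k M b (f t)) (isAffineLocalizing_pullback_universalQuotient k M b f)
    (fun I _ hW hle => ker_sectionsMap_pullback_universalQuotient_of_le k M b f I hW hle) hV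

/-- **EVERY `T`-POINT OF THE GRASSMANNIAN IS THE CLASSIFYING MORPHISM OF ITS OWN PULL-BACK OF THE UNIVERSAL QUOTIENT**:
for `f g : T ⟶ grassmannianScheme M k`, `g` induces on every affine open the kernels of the sections maps of `f^*(𝒬, q)`
(the classifying property of ★ `existsUnique_hom_ker_sectionsMap` / `existsUnique_hom_of_epi`) iff `g = f`.  Together with
★ `existsUnique_hom_of_epi_freeModule` (B-p21) — every rank-`k` quotient of `𝒪_T ⊗ M` HAS a classifying morphism — this is the
universal property of `(grassmannianScheme M k, 𝒬, q)` [GortzWedhorn2020, (8.4)]: `Grass_k(M)(T) = {rank-k quotients of 𝒪_T ⊗ M}`.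
[cite: GortzWedhorn2020, (8.4) (pp. 213–215)] [cite: StacksProject, Tag 089R] -/
theorem forall_evalAffine_eq_ker_pullback_iff (g : T ⟶ grassmannianScheme M k) :
    (∀ V : T.affineOpens, (evalAffine V.2 (pointsEquiv M k T g)).toSubmodule =
      LinearMap.ker (sectionsMap b ((Scheme.Modules.pullback f).obj (universalQuotient k M b))
        (fun j => unitSection f (universalQuotient k M b) ⊤ (universalQuotientSection k M b j)) V)) ↔ g = f := by
  constructor
  · intro h
    exact hom_ext_of_evalAffine M k fun V hV =>
      Module.Grassmannian.ext ((h ⟨V, hV⟩).trans (ker_sectionsMap_pullback_universalQuotient k M b f hV))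
  · rintro rfl V
    exact (ker_sectionsMap_pullback_universalQuotient k M b g V.2).symm

/-- `∃!` form: `f` is THE morphism classifying `f^*(𝒬, q)`. [cite: GortzWedhorn2020, (8.4) (pp. 213–215)] -/
theorem existsUnique_evalAffine_eq_ker_pullback :
    ∃! g : T ⟶ grassmannianScheme M k, ∀ V : T.affineOpens, (evalAffine V.2 (pointsEquiv M k T g)).toSubmodule =
      LinearMap.ker (sectionsMap b ((Scheme.Modules.pullback f).obj (universalQuotient k M b))
        (fun j => unitSection f (universalQuotient k M b) ⊤ (universalQuotientSection k M b j)) V) :=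
  ⟨f, (forall_evalAffine_eq_ker_pullback_iff k M b f f).2 rfl, fun g hg => (forall_evalAffine_eq_ker_pullback_iff k M b f g).1 hg⟩

/-- **The universal quotient itself is classified by the identity** (the case `f = 𝟙`: `ker θ_V(𝒬, q) = x₀|_V` on every affine
`V ⊆ Gr`, up to `𝟙^*𝒬`). [cite: GortzWedhorn2020, (8.4) (pp. 213–215)] -/
theorem forall_evalAffine_eq_ker_universalQuotient_iff (g : grassmannianScheme M k ⟶ grassmannianScheme M k) :
    (∀ V : (grassmannianScheme M k).affineOpens, (evalAffine V.2 (pointsEquiv M k _ g)).toSubmodule =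
      LinearMap.ker (sectionsMap b ((Scheme.Modules.pullback (𝟙 (grassmannianScheme M k))).obj (universalQuotient k M b))
        (fun j => unitSection (𝟙 _) (universalQuotient k M b) ⊤ (universalQuotientSection k M b j)) V)) ↔ g = 𝟙 _ :=
  forall_evalAffine_eq_ker_pullback_iff k M b (𝟙 _) g

end Universal

end Literature.AlgebraicGeometry.Motives.Grassmannian

end
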